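import Mathlib
import HarnessLib
import Summits.Langlands.Langlands.Theses.ParityBlindBianchi
import Summits.Langlands.Langlands.Theses.RuelleTorsionArtinWeight
import Literature.Barriers.Langlands.NonRegularWeightBarrier
import Literature.NumberTheory.Automorphic.UnitaryLimitsOfDiscreteSeries

/-!
# Sketch — crux idea `weight-two-eisenstein-host` for stmt-Langlands-11057 (ArtinWeightRealisation)

First checkable statements of the line "Siegel–Eisenstein shift to the coherent wall of U(2,2)":

* `hostWeight = (-1,0,0,1)`: the integral, NON-dominant weight of `GL₄ = U(2,2)_ℂ` whose
  cohomological infinity type has `a`-exponents `{1/2, 1/2, -1/2, -1/2}` = the Artin exponents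
  `{0,0}` of `σ` shifted by `±1/2` (Siegel induction at `s = 1/2`); it is C-algebraic and SINGULAR
  (a wall in the sense of `NonRegularWeightBarrierNarrow`), and it is the Harish-Chandra parameter
  `(1/2,-1/2 | 1/2,-1/2)` of the NON-DEGENERATE limits of discrete series of `U(2,2)` (tree:
  `LDSDatum.twinDatum`, n = 2) — coherently visible (Goldring–Koskivirta) — and of the holomorphic
  scalar-weight-2 module (Kudla–Sweet; not in the tree).
* `GL4HostPattern` / `GL4HostExit`: the GL₄-level shape of the classical host object (an automorphic
  representation of `GL₄(𝔸_K)` — any constituent of the space of automorphic forms, Borel–Jacquet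
  4.6 = the tree's `AutomorphicRepData` — whose Satake multiset splits BY ABSOLUTE VALUE into a
  `q^{-1/2}`-half matching `σ` and a `q^{+1/2}`-half) and the EXIT statement (Langlands 1979
  Prop. 2 cuspidal support + Jacquet–Shalika bounds + Chebotarev/Brauer–Nesbitt ⇒ a cuspidal `π` on
  `GL₂(𝔸_K)` matching `σ` a.e.).
* `crux_of_host`: pure logic — (Host: the crux hypothesis ⇒ `GL4HostPattern`) → `GL4HostExit` →
  `ArtinWeightRealisation` BY NAME (route decl of ParityBlindBianchi; the RuelleTorsionArtinWeight
  decl is the same item, verbatim).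
-/

noncomputable section

open scoped BigOperators Topology Manifold Classical MeasureTheory ProbabilityTheory Matrix InnerProductSpace ComplexConjugate ContinuousMap Polynomial NumberField
open Literature.NumberTheory.Automorphic Literature.NumberTheory.GaloisRepresentations
  Literature.Barriers.Langlands IsDedekindDomain NumberField Filter

set_option linter.dupNamespace false

namespace Summit.Langlands.Langlands.Cruxes.ArtinWeightRealisation.WeightTwoEisensteinHost

/-! ## 1. The host wall weight of `U(2,2)` / `GL₄` -/

/-- The host weight `λ̃ = (-1, 0, 0, 1) ∈ ℤ⁴` (increasing, hence NOT dominant): `λ̃ + ρ =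
(1/2, 1/2, -1/2, -1/2)`, the infinitesimal character of Siegel-induced `π_{0,0} ⊗ |det|^{1/2}` and of
scalar-weight-2 Hermitian modular forms on `U(2,2)`. -/
def hostWeight : Fin 4 → ℤ := ![-1, 0, 0, 1]

/-- The host weight is not dominant (no algebraic local system `V_λ̃`). -/
theorem not_isDominant_hostWeight :
    ¬ Literature.NumberTheory.DiophantineGeometry.Weight.IsDominant hostWeight := by
  intro h
  have h01 := h (show (0 : Fin 4) ≤ 3 by decide)
  simp [hostWeight] at h01

/-- The host infinity type (the cohomological formula at the wall weight) is C-algebraic. -/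
theorem isCAlgebraic_host (K : Type) [Field K] :
    (cohomologicalInfinityType 4 K hostWeight).IsCAlgebraic :=
  isCAlgebraic_cohomologicalInfinityType 4 K hostWeight

/-- … and SINGULAR: `λ̃_0 - 0 = λ̃_1 - 1` (and `λ̃_2 - 2 = λ̃_3 - 3`): two walls at once. -/
theorem not_isRegular_host (K : Type) [Field K] [NumberField K] :
    ¬ (cohomologicalInfinityType 4 K hostWeight).IsRegular := by
  rw [isRegular_cohomologicalInfinityType_iff]
  intro h
  have h01 := @h 0 1 (by simp [hostWeight])
  exact absurd h01 (by decide)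

/-- The `a`-exponents of the host type are `{1/2, 1/2, -1/2, -1/2}`: the Artin exponents `{0, 0}` of
`σ` (type `maassQuarterInfinityType`) Siegel-shifted by `+1/2` and by `-1/2`. -/
theorem host_a_exponents (K : Type) [Field K] (τ : K →+* ℂ) :
    (cohomologicalInfinityType 4 K hostWeight τ).map ArchWeight.a =
      {(1 / 2 : ℂ), 1 / 2, -(1 / 2), -(1 / 2)} := by
  simp only [cohomologicalInfinityType_apply, Multiset.map_map, Function.comp_def,
    cohomologicalArchWeight_a, hostWeight, rhoGL]
  simp [Fin.univ_val_map, List.ofFn_succ, Multiset.insert_eq_cons]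
  norm_num
  rfl

/-! ## 2. The same parameter as a NON-DEGENERATE limit of discrete series of `U(2,2)` -/

/-- `k = (1/2, -1/2)`. -/
def hostK : Fin 2 → ℚ := ![1 / 2, -(1 / 2)]

theorem hostK_strictAnti : StrictAnti hostK := by
  intro i j hij
  fin_cases i <;> fin_cases j <;> simp_all [hostK]

theorem hostK_half : ∀ t, ∃ m : ℤ, hostK t = m + 1 / 2 := by
  intro t
  fin_cases t
  · exact ⟨0, by simp [hostK]⟩
  · exact ⟨-1, by simp [hostK]; norm_num⟩

/-- The `U(2,2)` Harish-Chandra datum `(1/2, -1/2 | 1/2, -1/2)` with chamber `Ψ_ε` (four chambers). -/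
def hostTwin (ε : Fin 2 → Bool) : LDSDatum 2 2 :=
  LDSDatum.twinDatum hostK hostK_strictAnti hostK_half ε

/-- Each `π((1/2,-1/2 | 1/2,-1/2), Ψ_ε)` is a NON-DEGENERATE limit of discrete series of `U(2,2)`
(hence seen by coherent cohomology of the `U(2,2)` Shimura variety, Goldring–Koskivirta 2019 §2.2.2,
Thm. 2.2.1) — in contrast with the Artin parameter of `GL₂/K` itself. -/
theorem hostTwin_nondegenerate (ε : Fin 2 → Bool) :
    (hostTwin ε).IsNondegenerateLimitOfDiscreteSeries :=
  LDSDatum.isNondegenerateLimitOfDiscreteSeries_twinDatum hostK hostK_strictAnti hostK_half ε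

/-- … a PROPER limit (singular parameter). -/
theorem hostTwin_not_isRegular (ε : Fin 2 → Bool) : ¬ (hostTwin ε).IsRegular :=
  LDSDatum.not_isRegular_twinDatum hostK hostK_strictAnti hostK_half ε (by decide)

/-! ## 3. The GL₄-level host pattern and the EXIT -/

variable (K : Type) [Field K] [NumberField K] (p : ℕ) [Fact p.Prime]

/-- **Host pattern** (GL₄-level shape of the classical object the line manufactures on `U(2,2)` and
transfers to `GL₄/K`): an automorphic representation `Θ` of `GL₄(𝔸_K)` — ANY irreducible
constituent of the space of automorphic forms (`AutomorphicRepData`, Borel–Jacquet 4.6: Eisenstein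
and residual constituents allowed) — whose Satake multiset at a.e. `v` is `A·q_v^{-1/2} ⊎ B·q_v^{1/2}`
with `B` unitary and `A` (automatically unitary: roots of unity through `ι`) carrying the
arithmetic-Frobenius polynomial of `σ` — the scalar-weight-2 Siegel–Eisenstein shape. -/
def GL4HostPattern (ι : PadicAlgCl p ≃+* ℂ) (σ : FramedGaloisRep K (PadicAlgCl p) 2) : Prop :=
  ∃ (hcpt4 : isCompact_glFiniteIntegralLevel 4 K) (Θ : AutomorphicRepData (AutomorphyDatum.gl 4 K hcpt4)),
    ∀ᶠ v : HeightOneSpectrum (𝓞 K) in cofinite, ∃ A B : Multiset ℂ,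
      Θ.HasSatakeParamAt v
          (A.map (fun a ↦ a * (((Real.sqrt (v.residueCard : ℝ) : ℝ) : ℂ))⁻¹) +
            B.map (fun b ↦ b * ((Real.sqrt (v.residueCard : ℝ) : ℝ) : ℂ))) ∧
        (∀ b ∈ B, ‖b‖ = 1) ∧
        σ.IsUnramifiedAt v ∧ σ.HasFrobCharpolyAt v (arithFrobPolyOfSatake ι v.residueCard 1 A)

/-- **EXIT from the non-tempered host** (theorem-level, no `p`-adic input): cuspidal support
(Langlands 1979, Prop. 2: every automorphic representation is a constituent of
`Ind_P(τ₁|·|^{s₁} ⊗ ⋯)`, `τ_i` unitary cuspidal), Jacquet–Shalika bounds `q^{-1/2} < |α| < q^{1/2}`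
for unitary cuspidal `τ_i` (so pieces sort by `s_i`), unitarity of central characters (forces
`s = 1/2` for the `A`-half) and Chebotarev + Brauer–Nesbitt with `σ` irreducible (excludes two
characters) ⇒ the `A`-half is ONE cuspidal `τ` on `GL₂(𝔸_K)` with Satake parameters matching `σ`. -/
def GL4HostExit : Prop :=
  ∀ (K : Type) [Field K] [NumberField K] (p : ℕ) [Fact p.Prime] (ι : PadicAlgCl p ≃+* ℂ)
    (σ : FramedGaloisRep K (PadicAlgCl p) 2), Finite σ.toMonoidHom.range →
      σ.toGaloisRep.IsIrreducible → GL4HostPattern K p ι σ →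
        ∃ (hcpt : isCompact_glFiniteIntegralLevel 2 K) (π : CuspidalAutomorphicRepData 2 K hcpt),
          ∀ᶠ w : HeightOneSpectrum (𝓞 K) in cofinite, Summit.Langlands.SatakeFrobCompatibleAt ι π.1 σ w

/-! ## 4. The crux hypothesis (verbatim) and the glue -/

/-- The occurrence hypothesis of the crux, VERBATIM (σ is an `𝒪_{ℚ̄_p}`-point of `Spf 𝕋(U^p)` of the
`p`-power Bianchi tower, Hansen-associated outside `S`). -/
def OccursPadically (σ : FramedGaloisRep K (PadicAlgCl p) 2) : Prop :=
  ∃ (S : Finset (IsDedekindDomain.HeightOneSpectrum (NumberField.RingOfIntegers K))) (U : Subgroup (GL (Fin 2) (IsDedekindDomain.FiniteAdeleRing (NumberField.RingOfIntegers K) K))) (ϖ : ∀ v : IsDedekindDomain.HeightOneSpectrum (NumberField.RingOfIntegers K), (v.adicCompletion K)ˣ) (a : {v : IsDedekindDomain.HeightOneSpectrum (NumberField.RingOfIntegers K) // v ∉ S} → ℕ → (Valued.v (R := PadicAlgCl p)).valuationSubring), (∀ v : IsDedekindDomain.HeightOneSpectrum (NumberField.RingOfIntegers K), ((p : ℕ)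 : NumberField.RingOfIntegers K) ∈ v.asIdeal → v ∈ S) ∧ IsOpen (U : Set (GL (Fin 2) (IsDedekindDomain.FiniteAdeleRing (NumberField.RingOfIntegers K) K))) ∧ U ≤ Literature.NumberTheory.Automorphic.glFiniteIntegralLevel 2 K ∧ (∀ g ∈ Literature.NumberTheory.Automorphic.glFiniteIntegralLevel 2 K, (∀ v ∈ S, ∀ i j : Fin 2, ((g : Matrix (Fin 2) (Fin 2) (IsDedekindDomain.FiniteAdeleRing (NumberField.RingOfIntegers K) K)) i j) v = (1 : Matrix (Fin 2) (Fin 2) (v.adicCompletion K)) i j) → g ∈ U) ∧ (∀ v : IsDedekindDomain.HeightOneSpectrum (NumberField.RingOfIntegers K), Valued.v ((ϖ v : (v.adicCompletion K)ˣ) : v.adicCompletion K) = WithZero.exp (-1 : ℤ)) ∧ Literature.NumberTheory.Automorphic.IsHeckePoint (Matrix.GeneralLinearGroup.map (n := Fin 2) (algebraMap K (IsDedekindDomain.FiniteAdeleRing (NumberField.RingOfIntegers K) K))) (Literature.NumberTheory.Automorphic.LevelTower.ofSeq U (fun r : ℕ => (Literature.NumberTheory.Automorphic.principalCongruenceLevel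 2 K (Ideal.span {((p : ℕ) : NumberField.RingOfIntegers K)} ^ r)).map (Literature.NumberTheory.Automorphic.GLn.sndHom 2 K))) ((p : ℕ) : (Valued.v (R := PadicAlgCl p)).valuationSubring) (fun j : {v : IsDedekindDomain.HeightOneSpectrum (NumberField.RingOfIntegers K) // v ∉ S} × Fin 2 => Literature.NumberTheory.Automorphic.GLn.sndHom 2 K (Literature.NumberTheory.Automorphic.heckeDiagAt 2 K j.1.1 (ϖ j.1.1) (j.2.val + 1))) (fun j => a j.1 (j.2.val + 1)) ∧ ∀ (v : IsDedekindDomain.HeightOneSpectrum (NumberField.RingOfIntegers K)) (hv : v ∉ S), σ.IsHeckeAssociatedAt v (fun i : ℕ => if i = 0 then (1 : PadicAlgCl p) else ((a ⟨v, hv⟩ i : (Valued.v (R := PadicAlgCl p)).valuationSubring) : PadicAlgCl p))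

/-- **HOST** (the line's content, = stubs S1 boundary transfer + S2 weight-two classicality on the
`U(2,2)` Shimura variety + S2c weak transfer `U(2,2) → GL₄/K` of the classical constituent): for
imaginary quadratic `K`, a finite-image irreducible `σ` that occurs `p`-adically has a host. -/
def Host : Prop :=
  ∀ (K : Type) [Field K] [NumberField K], NumberField.IsTotallyComplex K → Module.finrank ℚ K = 2 →
    ∀ (p : ℕ) [Fact p.Prime] (ι : PadicAlgCl p ≃+* ℂ) (σ : FramedGaloisRep K (PadicAlgCl p) 2),
      Finite σ.toMonoidHom.range → σ.toGaloisRep.IsIrreducible → OccursPadically K p σ →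
        GL4HostPattern K p ι σ

/-- **Glue (checked): Host → Exit → the crux BY NAME.** -/
-- buildfix 2026-08-19: the crux decl `ArtinWeightRealisation` (stmt-Langlands-11057) now lives in route
-- `RuelleTorsionArtinWeight` (verbatim the same item); `ParityBlindBianchi` only keeps `ArtinWeightRealisationEven`.
theorem crux_of_host (hHost : Host) (hExit : GL4HostExit) :
    Summit.Langlands.Langlands.Theses.RuelleTorsionArtinWeight.ArtinWeightRealisation := by
  intro K _ _ hK h2 p _ ι σ hfin hirr hocc
  exact hExit K p ι σ hfin hirr (hHost K hK h2 p ι σ hfin hirr hocc)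

end Summit.Langlands.Langlands.Cruxes.ArtinWeightRealisation.WeightTwoEisensteinHost

end
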